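import Summits.QuantumFields.YangMills.Theorems.BalabanUVNodesN08HaarCompatibilityGuardCoreChartConjugateSUN
import Summits.QuantumFields.YangMills.Theorems.BalabanUVNodesN08HaarCompatibilityGuardFibreCore
import Summits.QuantumFields.YangMills.Theorems.BalabanUVNodesN08HaarCompatibilityGuardPowerMap

/-!
# BalabanUVNodes ∕ N08 — (H_K-core) AND (H_K) FOR EVERY `N` AND EVERY BLOCK SIZE `L`: the law of the printed exp-mean-log core map on `SU(N)` is
# `≤ K·Haar` with ONE fibre-uniform `K < ∞`; part 20's one-step extensive transport bound at the [B10] slot WITHOUT the range hypothesis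

WIDTH SEAT `pub-ymgap-dag-n08-w6` g5, item-3 lineage, 2026-08-28 (INTENT-3).  DAG node N08 = [Balaban1985UV3] Thm 1 p. 257 (compact) + Thm 2 p. 272; the typed
(0.4) averaging and its guard = [Balaban1987RG1] (0.4) p. 253; key item K1⁷ `StabilityBAtRecordR13SepCoPH` (stmt-QuantumFields-20542), `--supports … --as helper`.
COUNT-NEUTRAL.

THE POINT.  n08-w3 g5's part 27C (`…GuardCoreLawSU2`) discharges the per-fibre density hypothesis (H_K) of part 20 at `N = 2` on the range `L^{d−1} ≤ 9` with a
closed constant; the record's [B13] closers want block sizes `8 ≤ θ.L` (n08-w3 g5, I.36776), where neither the quaternion model nor the no-sheet-count range is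
available.  THIS FILE closes (H_K-core) — hence (H_K) and part 20's bound — for EVERY `N ≥ 1` and EVERY block size, at the price of an EXISTENTIAL constant:
 §1 ★★★ `exists_map_haar_le_of_kmat_on_open` — for weights `cᵢ ≥ 0` with `Σcᵢ < 1` on a finite index type there is ONE `K < ∞` such that for EVERY family
    `V : ι → SU(N)`, EVERY open set `O` of guarded points (`‖Vᵢw* − 1‖ < deltaSU`) and EVERY Borel `Φ : SU(N) → SU(N)` with `Φ = Kmat V c` on `O` and `Φ = id`
    off `O`:  **`Haar∘Φ⁻¹ ≤ K•Haar`**.  Mechanism (all BY IMPORT): uniform radii (p626433 `exists_bound_emlD` ∕ `uniform_injectivity_windows`, lit-balaban's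
    `chartRadius`∕`innerRadius`∕`exists_ball_det_jac_pos`), a finite cover of the compact group by translated chart windows (INTENT-1
    `exists_finset_cover_translate_window`), a guarded centre chosen in every window piece meeting `O`, the chart conjugates of INTENT-2
    (`…GuardCoreWindowLipschitzSUN` ∕ `…GuardCoreChartConjugateSUN`: `semiconj` ∕ `norm_conj_chart_lt` ∕ `injOn_conj` ∕ `differentiableAt_conj` ∕ `jacobian_ge`), and
    INTENT-1's frame `haar_map_le_of_windows_id`;
    `K = (1 − Σcᵢ)^{−(N²−1)}·#cover + 1`.
 §2 ★★★ `exists_core_law_le` — (H_K-core) of part 24 for the PRINTED `SU(N)` average, EVERY `N`, EVERY coarse bond and frozen family, ONE `K` (the core map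
    IS `Kmat` on its open guard by p624108 `core_eq_kmat` ∕ `guard_of_core`, the identity off it; `Σcᵢ = #non-central∕|Idx| < 1` by part 11's `nCentral_pos`);
    ★★ `exists_fibre_law_le` — (H_K) for every `N` (part 24 `fibre_law_le_of_core`); ★★★ `exists_smul_map_avOfPrint_le` — PART 20's ONE-STEP EXTENSIVE
    TRANSPORT BOUND AT THE [B10] SLOT FOR EVERY `N` AND EVERY `L`, (H_K) DISCHARGED, `K` existential (part 24 `smul_map_avOfPrint_le_of_core`).

HONEST FRAMING.  [folklore] measure theory ∕ bookkeeping BY IMPORT; `K` is EXISTENTIAL (a closed number only at `N = 2`, n08-w3's 27C ∕ INTENT-9); ONE RG step at fixed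
ε on a finite torus — the k-UNIFORM `hmass` of the node's Theorem-1 letter is NOT supplied (stacking), E6′ NOT decided; nothing of Bałaban's asserted; count-neutral;
N08 NOT discharged; counts unmoved (typed 28∕28 · discharged 5∕27); R4 closes the CONDITIONAL rung `BalabanLadder.UV` only; the Yang–Mills mass gap (Clay) is NOT
proved; nothing continuum ∕ OS.  0 `sorry`, 0 `def`, 0 `instance`, 0 `notation`, standard axioms.
-/

noncomputable section

open NormedSpace Set Function Filter Topology MeasureTheory
open scoped ENNReal NNReal Matrix Matrix.Norms.L2Operator

namespace Summit.QuantumFields.YangMills.BalabanUVNodes.N08HaarCompatibilityGuardCoreLawSUN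

open Literature.MathematicalPhysics.QuantumFieldTheory (haarProbability)
open Literature.MathematicalPhysics.QuantumFieldTheory.Balaban1983to89
open Literature.MathematicalPhysics.QuantumFieldTheory.Balaban1983to89.HaarExponentialChart
open Literature.MathematicalPhysics.QuantumFieldTheory.Balaban1983to89.HaarExponentialChart.IsChartRep (chartRadius innerRadius chartRadius_pos innerRadius_pos)
open Literature.MathematicalPhysics.QuantumFieldTheory.Balaban1983to89.B13HaarSigmaJacobian (jac)
open Literature.MathematicalPhysics.QuantumFieldTheory.Balaban1983to89.T4EMLTangentInjective (Kmat emlD)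
open Literature.MathematicalPhysics.QuantumFieldTheory.Balaban1983to89.ExpMeanLog (deltaSU lt_third_of_lt_deltaSU expMeanLogSU measurable_expMeanLogSU_E)
open Literature.MathematicalPhysics.QuantumFieldTheory.Balaban1983to89.MatrixLog (mlog)
open Literature.MathematicalPhysics.QuantumFieldTheory.Balaban1983to89.BlockAveraging (Idx Small avgFun)
open Literature.MathematicalPhysics.QuantumFieldTheory.Balaban1983to89.BlockAveragingHaarAC (IsCentral centralBond nCentral nCentral_pos)
open Literature.MathematicalPhysics.QuantumFieldTheory.Balaban1985CMP102.Setting (Scales)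
open Literature.MathematicalPhysics.QuantumFieldTheory.Balaban1983to89.B10RunsOfRecord (avOfPrint)
open Literature.MathematicalPhysics.QuantumLattice (fundamentalRep fundamentalRep_apply)
open Summit.QuantumFields.YangMills.BalabanUVNodes.N08HaarCompatibilityGuardIntrinsicJacobian
open Summit.QuantumFields.YangMills.BalabanUVNodes.N08HaarCompatibilityGuardCoreWindowLipschitzSUN
open Summit.QuantumFields.YangMills.BalabanUVNodes.N08HaarCompatibilityGuardCoreChartConjugateSUN
open Summit.QuantumFields.YangMills.BalabanUVNodes.N08HaarCompatibilityGuardInjectivityWindows (uniform_injectivity_windows exists_bound_emlD exists_norm_exp_sub_one_lt)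
open Summit.QuantumFields.YangMills.BalabanUVNodes.N08HaarCompatibilityGuardCoreKmatDictionary (core_eq_kmat guard_of_core)
open Summit.QuantumFields.YangMills.BalabanUVNodes.N08HaarCompatibilityGuardFibreCore (measurable_core fibre_law_le_of_core smul_map_avOfPrint_le_of_core)
open Summit.QuantumFields.YangMills.BalabanUVNodes.N08HaarCompatibilityGuardPowerMap (nCentral_le_card)

variable {N : ℕ} [NeZero N]

/-! ## §1 ONE constant for every family, every open guarded set, every `N` -/

section Generic

variable {ι : Type*} [Fintype ι]

/-- **THE TRANSITION BOUND**: for `A, B` in the chart algebra with `‖e^{A} − 1‖ < η`, `‖e^{B} − 1‖ < η`: `‖↑((Θ A)⁻¹·Θ B) − 1‖ < 2η` (unitary isometry).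
[cite: Helgason2000, Ch. I §1 Thm. 1.14 (13) p. 96] -/
theorem norm_coe_inv_mul_sub_one_lt {η : ℝ} {A B : (specialUnitaryLogChart (Fin N)).lie}
    (hA : ‖exp (A : Matrix (Fin N) (Fin N) ℂ) - 1‖ < η) (hB : ‖exp (B : Matrix (Fin N) (Fin N) ℂ) - 1‖ < η) :
    ‖((((isChartRep_specialUnitaryGroup (n := Fin N)).expChart A)⁻¹ * (isChartRep_specialUnitaryGroup (n := Fin N)).expChart B :
        Matrix.specialUnitaryGroup (Fin N) ℂ) : Matrix (Fin N) (Fin N) ℂ) - 1‖ < 2 * η := by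
  have hAu : exp (A : Matrix (Fin N) (Fin N) ℂ) ∈ Matrix.unitaryGroup (Fin N) ℂ := by
    have h := (Matrix.mem_specialUnitaryGroup_iff.mp ((isChartRep_specialUnitaryGroup (n := Fin N)).expChart A).2).1
    rwa [coe_expChart] at h
  rw [Submonoid.coe_mul, coe_inv_eq_star, coe_expChart, coe_expChart]
  have e : star (exp (A : Matrix (Fin N) (Fin N) ℂ)) * exp (B : Matrix (Fin N) (Fin N) ℂ) - 1 =
      star (exp (A : Matrix (Fin N) (Fin N) ℂ)) * ((exp (B : Matrix (Fin N) (Fin N) ℂ) - 1) - (exp (A : Matrix (Fin N) (Fin N) ℂ) - 1)) := by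
    rw [sub_sub_sub_cancel_right, mul_sub, Matrix.mem_unitaryGroup_iff'.mp hAu]
  rw [e, CStarRing.norm_mem_unitary_mul _ (Unitary.star_mem hAu)]
  calc ‖(exp (B : Matrix (Fin N) (Fin N) ℂ) - 1) - (exp (A : Matrix (Fin N) (Fin N) ℂ) - 1)‖
      ≤ ‖exp (B : Matrix (Fin N) (Fin N) ℂ) - 1‖ + ‖exp (A : Matrix (Fin N) (Fin N) ℂ) - 1‖ := norm_sub_le _ _
    _ < η + η := add_lt_add hB hA
    _ = 2 * η := by ring

/-- ★★★ **ONE CONSTANT FOR EVERY FAMILY AND EVERY GUARDED OPEN SET.**  For weights `cᵢ ≥ 0`, `Σcᵢ < 1` on a finite index type and every `N ≥ 1` there is `K < ∞`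
(`1 ≤ K`) such that: for EVERY `V : ι → SU(N)`, EVERY open `O ⊆ SU(N)` of guarded points (`‖Vᵢw* − 1‖ < deltaSU` on `O`) and EVERY Borel `Φ : SU(N) → SU(N)`
with `↑(Φ w) = Kmat V c ↑w` on `O` and `Φ w = w` off `O`:  **`Haar∘Φ⁻¹ ≤ K•Haar`**  (`K = (1 − Σcᵢ)^{−(N²−1)}·#cover + 1`, the cover a finite set of translated
chart windows of `SU(N)` depending on `N`, `ι`, `c` only).
[cite: Helgason2000, Ch. I §1 Thm. 1.14 (13) p. 96] [cite: Balaban1987RG1, (0.4) p.253 (the printed operation; the bound is bookkeeping, NOT in print)] -/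
theorem exists_map_haar_le_of_kmat_on_open (c : ι → ℝ) (hc0 : ∀ i, 0 ≤ c i) (hc1 : ∑ i, c i < 1) :
    ∃ K : ℝ≥0∞, 1 ≤ K ∧ K ≠ ∞ ∧
      ∀ (V : ι → Matrix.specialUnitaryGroup (Fin N) ℂ) (Φ : Matrix.specialUnitaryGroup (Fin N) ℂ → Matrix.specialUnitaryGroup (Fin N) ℂ)
        (O : Set (Matrix.specialUnitaryGroup (Fin N) ℂ)), IsOpen O → Measurable Φ →
        (∀ w ∈ O, ∀ i, ‖(V i : Matrix (Fin N) (Fin N) ℂ) * star (w : Matrix (Fin N) (Fin N) ℂ) - 1‖ < deltaSU (Fin N)) →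
        (∀ w ∈ O, ((Φ w : Matrix.specialUnitaryGroup (Fin N) ℂ) : Matrix (Fin N) (Fin N) ℂ) =
          Kmat (fun i => (V i : Matrix (Fin N) (Fin N) ℂ)) c (w : Matrix (Fin N) (Fin N) ℂ)) →
        (∀ w, w ∉ O → Φ w = w) →
        (haarProbability (Matrix.specialUnitaryGroup (Fin N) ℂ)).map Φ ≤ K • haarProbability (Matrix.specialUnitaryGroup (Fin N) ℂ) := by
  classical
  -- uniform radii
  obtain ⟨B, hB0, hB⟩ := exists_bound_emlD (m := Fin N) c (show (1 / 2 : ℝ) < 1 by norm_num)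
  obtain ⟨rₑ, hrₑ, hre⟩ := exists_norm_exp_sub_one_lt (m := Fin N) (show (0 : ℝ) < 1 / 6 by norm_num)
  obtain ⟨r₉, hr₉, h9⟩ := uniform_injectivity_windows (m := Fin N) c hc0 hc1 (show (1 / 3 : ℝ) < 1 / 2 by norm_num)
  obtain ⟨s₀, hs₀, hjacpos⟩ := exists_ball_det_jac_pos (lie_adStable_specialUnitaryGroup (n := Fin N))
  have hsC0 : 0 < chartRadius (specialUnitaryLogChart (Fin N)) := chartRadius_pos
  have hiC0 : 0 < innerRadius (specialUnitaryLogChart (Fin N)) := innerRadius_pos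
  set s : ℝ := min s₀ (chartRadius (specialUnitaryLogChart (Fin N))) with hs_def
  have hs0 : 0 < s := lt_min hs₀ hsC0
  have hsC : s ≤ chartRadius (specialUnitaryLogChart (Fin N)) := min_le_right _ _
  have hss₀ : s ≤ s₀ := min_le_left _ _
  set r : ℝ := min (min (min (1 / 2) rₑ) (min r₉ s)) (min (innerRadius (specialUnitaryLogChart (Fin N)) / (2 * B)) (s / (4 * B))) with hr_def
  have hr0 : 0 < r := by positivity
  have hr2 : r ≤ 1 / 2 := (min_le_left _ _).trans ((min_le_left _ _).trans (min_le_left _ _))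
  have hrre : r ≤ rₑ := (min_le_left _ _).trans ((min_le_left _ _).trans (min_le_right _ _))
  have hrr₉ : r ≤ r₉ := (min_le_left _ _).trans ((min_le_right _ _).trans (min_le_left _ _))
  have hrs' : r ≤ s := (min_le_left _ _).trans ((min_le_right _ _).trans (min_le_right _ _))
  have hrB : 2 * B * r ≤ innerRadius (specialUnitaryLogChart (Fin N)) := by
    have h1 : r ≤ innerRadius (specialUnitaryLogChart (Fin N)) / (2 * B) := (min_le_right _ _).trans (min_le_left _ _)
    rw [le_div_iff₀ (by positivity)] at h1; linarith
  have hrs : 4 * B * r ≤ s := by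
    have h1 : r ≤ s / (4 * B) := (min_le_right _ _).trans (min_le_right _ _)
    rw [le_div_iff₀ (by positivity)] at h1; linarith
  have hre' : ∀ Z : Matrix (Fin N) (Fin N) ℂ, ‖Z‖ < r → ‖exp Z - 1‖ < 1 / 6 := fun Z hZ => hre Z (hZ.trans_le hrre)
  -- the cover radius and the finite cover
  set η : ℝ := min (innerRadius (specialUnitaryLogChart (Fin N))) r / 5 with hη_def
  have hη0 : 0 < η := by positivity
  have hηi : 2 * η < innerRadius (specialUnitaryLogChart (Fin N)) := by
    have := min_le_left (innerRadius (specialUnitaryLogChart (Fin N))) r; rw [hη_def]; linarith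
  have hηr : 4 * η < r := by
    have := min_le_right (innerRadius (specialUnitaryLogChart (Fin N))) r; rw [hη_def]; linarith
  obtain ⟨r₁', hr₁', hη⟩ := exists_norm_exp_sub_one_lt (m := Fin N) hη0
  set r₁ : ℝ := min r₁' (chartRadius (specialUnitaryLogChart (Fin N))) with hr₁_def
  have hr₁0 : 0 < r₁ := lt_min hr₁' hsC0
  have hr₁C : r₁ ≤ chartRadius (specialUnitaryLogChart (Fin N)) := min_le_right _ _
  obtain ⟨t, ht⟩ := exists_finset_cover_translate_window (isChartRep_specialUnitaryGroup (n := Fin N)) hr₁0 hr₁C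
  -- the constant
  set m : ℝ≥0∞ := ENNReal.ofReal ((1 - ∑ i, c i) ^ (N ^ 2 - 1)) with hm_def
  have hm0 : m ≠ 0 := (ENNReal.ofReal_pos.2 (pow_pos (by linarith) _)).ne'
  have hmt : m ≠ ∞ := ENNReal.ofReal_ne_top
  refine ⟨m⁻¹ * t.card + 1, le_add_self, ENNReal.add_ne_top.2 ⟨ENNReal.mul_ne_top (ENNReal.inv_ne_top.2 hm0) (ENNReal.natCast_ne_top _),
    ENNReal.one_ne_top⟩, fun V Φ O hOo hΦm hO hΦ hid => ?_⟩
  have hVu : ∀ i, (V i : Matrix (Fin N) (Fin N) ℂ) ∈ Matrix.unitaryGroup (Fin N) ℂ := fun i => (Matrix.mem_specialUnitaryGroup_iff.mp (V i).2).1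
  letI : MeasurableSpace (specialUnitaryLogChart (Fin N)).lie := borel _
  haveI : BorelSpace (specialUnitaryLogChart (Fin N)).lie := ⟨rfl⟩
  -- a guarded centre in every window piece meeting `O`
  set Kf : Finset (Matrix.specialUnitaryGroup (Fin N) ℂ) :=
    t.filter (fun w => (O ∩ {x | w⁻¹ * x ∈ (isChartRep_specialUnitaryGroup (n := Fin N)).window r₁}).Nonempty) with hKf_def
  have hex : ∀ w ∈ Kf, ∃ W : Matrix.specialUnitaryGroup (Fin N) ℂ, W ∈ O ∩ {x | w⁻¹ * x ∈ (isChartRep_specialUnitaryGroup (n := Fin N)).window r₁} :=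
    fun w hw => (Finset.mem_filter.1 hw).2
  choose! W₀ hW₀ using hex
  have hcard : (Kf.card : ℝ≥0∞) ≤ t.card := by exact_mod_cast Finset.card_filter_le _ _
  -- `O` is covered by the translated windows of the guarded centres
  have hS : O ⊆ ⋃ w ∈ Kf, (fun x => (W₀ w)⁻¹ * x) ⁻¹' ((isChartRep_specialUnitaryGroup (n := Fin N)).expChart ''
      {X : (specialUnitaryLogChart (Fin N)).lie | ‖X‖ < r ∧ W₀ w * (isChartRep_specialUnitaryGroup (n := Fin N)).expChart X ∈ O}) := by
    intro x hx
    obtain ⟨w, hwt, hwx⟩ := ht x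
    have hwK : w ∈ Kf := Finset.mem_filter.2 ⟨hwt, x, hx, hwx⟩
    obtain ⟨hW₀O, hW₀p⟩ := hW₀ w hwK
    obtain ⟨A, hA, hAe⟩ := hW₀p
    obtain ⟨Bv, hBv, hBe⟩ := hwx
    rw [mem_ball_zero_iff] at hA hBv
    have hg : (W₀ w)⁻¹ * x = ((isChartRep_specialUnitaryGroup (n := Fin N)).expChart A)⁻¹ * (isChartRep_specialUnitaryGroup (n := Fin N)).expChart Bv := by
      rw [hAe, hBe]; group
    have hlt2 : ‖(((W₀ w)⁻¹ * x : Matrix.specialUnitaryGroup (Fin N) ℂ) : Matrix (Fin N) (Fin N) ℂ) - 1‖ < 2 * η := by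
      rw [hg]
      exact norm_coe_inv_mul_sub_one_lt (hη _ (by rw [Submodule.norm_coe]; exact hA.trans_le (min_le_left _ _)))
        (hη _ (by rw [Submodule.norm_coe]; exact hBv.trans_le (min_le_left _ _)))
    have hlt : ‖fundamentalRep (Fin N) ((W₀ w)⁻¹ * x) - 1‖ < innerRadius (specialUnitaryLogChart (Fin N)) := by
      rw [fundamentalRep_apply]; exact hlt2.trans hηi
    have hΘ : (isChartRep_specialUnitaryGroup (n := Fin N)).expChart ((isChartRep_specialUnitaryGroup (n := Fin N)).logChart ((W₀ w)⁻¹ * x)) = (W₀ w)⁻¹ * x :=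
      (isChartRep_specialUnitaryGroup (n := Fin N)).expChart_logChart hlt
    have hXr : ‖(isChartRep_specialUnitaryGroup (n := Fin N)).logChart ((W₀ w)⁻¹ * x)‖ < r := by
      rw [← Submodule.norm_coe, (isChartRep_specialUnitaryGroup (n := Fin N)).coe_logChart hlt, fundamentalRep_apply]
      have hhalf : ‖(((W₀ w)⁻¹ * x : Matrix.specialUnitaryGroup (Fin N) ℂ) : Matrix (Fin N) (Fin N) ℂ) - 1‖ ≤ 1 / 2 :=
        ((hlt2.trans hηi).trans_le IsChartRep.innerRadius_le_half).le
      calc ‖mlog (((W₀ w)⁻¹ * x : Matrix.specialUnitaryGroup (Fin N) ℂ) : Matrix (Fin N) (Fin N) ℂ)‖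
          ≤ 2 * ‖(((W₀ w)⁻¹ * x : Matrix.specialUnitaryGroup (Fin N) ℂ) : Matrix (Fin N) (Fin N) ℂ) - 1‖ := MatrixLog.norm_mlog_le_two_mul hhalf
        _ ≤ 2 * (2 * η) := by gcongr
        _ < r := by linarith
    refine mem_iUnion₂.2 ⟨w, hwK, ?_⟩
    refine ⟨(isChartRep_specialUnitaryGroup (n := Fin N)).logChart ((W₀ w)⁻¹ * x), ⟨hXr, ?_⟩, hΘ⟩
    rw [hΘ, mul_inv_cancel_left]; exact hx
  -- the frame
  have hle := haar_map_le_of_windows_id (isChartRep_specialUnitaryGroup (n := Fin N)) (lie_adStable_specialUnitaryGroup (n := Fin N))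
    (haarProbability (Matrix.specialUnitaryGroup (Fin N) ℂ)) hΦm hOo.measurableSet hid hs0 hsC Kf W₀ (fun w => Φ (W₀ w))
    (fun w => {X : (specialUnitaryLogChart (Fin N)).lie | ‖X‖ < r ∧ W₀ w * (isChartRep_specialUnitaryGroup (n := Fin N)).expChart X ∈ O})
    (fun w _ => (isOpen_windowSet (W₀ w) O hOo r).measurableSet)
    (fun w _ X hX => mem_ball_zero_iff.2 (hX.1.trans_le hrs'))
    (fun w _ X hX => (hjacpos X (hX.1.trans_le (hrs'.trans hss₀))).ne')
    (fun w X => (isChartRep_specialUnitaryGroup (n := Fin N)).logChart ((Φ (W₀ w))⁻¹ * Φ (W₀ w * (isChartRep_specialUnitaryGroup (n := Fin N)).expChart X)))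
    (fun w X => fderiv ℝ (fun Y : (specialUnitaryLogChart (Fin N)).lie =>
      (isChartRep_specialUnitaryGroup (n := Fin N)).logChart ((Φ (W₀ w))⁻¹ * Φ (W₀ w * (isChartRep_specialUnitaryGroup (n := Fin N)).expChart Y))) X)
    (fun w hw X hX => (differentiableAt_conj V c (W₀ w) Φ O hO hΦ (hW₀ w hw).1 hOo hB0 hB hr2 hre' hrB hX.1 hX.2).hasFDerivAt.hasFDerivWithinAt)
    (fun w hw => injOn_conj V c (W₀ w) Φ O hO hΦ (hW₀ w hw).1 hB0 hB hr2 hre' hrB hrr₉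
      (h9 (fun i => (V i : Matrix (Fin N) (Fin N) ℂ)) (W₀ w : Matrix (Fin N) (Fin N) ℂ) hVu (Matrix.mem_specialUnitaryGroup_iff.mp (W₀ w).2).1
        (fun i => (lt_third_of_lt_deltaSU (hO (W₀ w) (hW₀ w hw).1 i)).le)).1)
    (fun w hw X hX => mem_ball_zero_iff.2 (norm_conj_chart_lt V c (W₀ w) Φ O hO hΦ (hW₀ w hw).1 hB0 hB hr2 hre' hrB hrs hX.1 hX.2))
    (fun w hw X hX => semiconj V c (W₀ w) Φ O hO hΦ (hW₀ w hw).1 hB0 hB hr2 hre' hrB hX.1 hX.2) hm0 hmt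
    (fun w hw X hX => jacobian_ge V c (W₀ w) Φ O hO hΦ (hW₀ w hw).1 hOo hB0 hB hr2 hre' hrB hc0 hc1.le hX.1 hX.2
      (hjacpos X (hX.1.trans_le (hrs'.trans hss₀))).ne') hS
  refine hle.trans (Measure.le_iff'.2 fun A => ?_)
  rw [Measure.smul_apply, Measure.smul_apply, smul_eq_mul, smul_eq_mul]
  gcongr

end Generic

/-! ## §2 At the printed `SU(N)` average: (H_K-core), (H_K), and part 20's bound at the slot — every `N`, every `L` -/

section Slot

variable {P : Params} {j : ℕ}

/-- `dist1 = ‖· − 1‖` is continuous on `SU(N)` (operator norm of the fundamental representation; private copy of the one-liner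
`B12ContinuousTransportInvarianceOn.continuous_dist1_SU`, not to import that chain). [folklore] -/
theorem continuous_dist1_SUN : Continuous (dist1 : Matrix.specialUnitaryGroup (Fin N) ℂ → ℝ) :=
  UnitaryModel.continuous_opDist1.comp (Literature.MathematicalPhysics.QuantumLattice.continuous_fundamentalRep (Fin N))

/-- **THE GUARD SET OF THE CORE MAP IS OPEN.** [cite: Balaban1987RG1, (0.4) p.253 (bookkeeping)] -/
theorem isOpen_coreGuard (c : PBond P (j + 1)) (V : Idx P → Matrix.specialUnitaryGroup (Fin N) ℂ) :
    IsOpen {w : Matrix.specialUnitaryGroup (Fin N) ℂ | ∀ i : Idx P,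
      dist1 (if IsCentral c i then (1 : Matrix.specialUnitaryGroup (Fin N) ℂ) else V i * w⁻¹) <
        (expMeanLogSU : LoopAverage (Matrix.specialUnitaryGroup (Fin N) ℂ)).δ} := by
  rw [show {w : Matrix.specialUnitaryGroup (Fin N) ℂ | ∀ i : Idx P,
      dist1 (if IsCentral c i then (1 : Matrix.specialUnitaryGroup (Fin N) ℂ) else V i * w⁻¹) <
        (expMeanLogSU : LoopAverage (Matrix.specialUnitaryGroup (Fin N) ℂ)).δ} =
      ⋂ i : Idx P, {w | dist1 (if IsCentral c i then (1 : Matrix.specialUnitaryGroup (Fin N) ℂ) else V i * w⁻¹) <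
        (expMeanLogSU : LoopAverage (Matrix.specialUnitaryGroup (Fin N) ℂ)).δ} by ext w; simp]
  refine isOpen_iInter_of_finite fun i => ?_
  by_cases h : IsCentral c i
  · simp only [if_pos h]; exact isOpen_const
  · simp only [if_neg h]
    exact isOpen_lt (continuous_dist1_SUN.comp (continuous_const.mul continuous_inv)) continuous_const

/-- `#non-central∕|Idx| < 1` (part 11's `nCentral_pos`: the coarse bond has central indices). [folklore] -/
theorem sum_weights_lt_one (c : PBond P (j + 1)) :
    ∑ _i : {i : Idx P // ¬ IsCentral c i}, ((Fintype.card (Idx P) : ℝ))⁻¹ < 1 := by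
  classical
  have hcard : (0 : ℝ) < Fintype.card (Idx P) := Nat.cast_pos.mpr Fintype.card_pos
  rw [Finset.sum_const, Finset.card_univ, nsmul_eq_mul, ← div_eq_mul_inv, div_lt_one hcard]
  have h1 : Fintype.card {i : Idx P // IsCentral c i} = nCentral c := by rw [nCentral, Fintype.card_subtype]
  have h2 := Fintype.card_subtype_compl (IsCentral c)
  rw [h1] at h2
  have h3 := nCentral_pos c
  have h4 := nCentral_le_card c
  exact_mod_cast (show Fintype.card {i : Idx P // ¬ IsCentral c i} < Fintype.card (Idx P) by omega)

/-- ★★★ **(H_K-core) FOR EVERY `N`, EVERY COARSE BOND AND FROZEN FAMILY, ONE CONSTANT**: for the printed `SU(N)` average there is `K < ∞` (`1 ≤ K`; depending on `N`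
and the lattice parameters, NOT on the bond or the family) with  **`Haar ∘ Φ_V⁻¹ ≤ K•Haar`**  for the lattice-free core map `Φ_V` of part 24 (`…GuardFibreCore`) of every
coarse bond `c` and every `V : Idx → SU(N)` — the hypothesis `hKc` of part 24's `fibre_law_le_of_core` ∕ `smul_map_avOfPrint_le_of_core`, with NO range hypothesis.
[cite: Balaban1987RG1, (0.4) p.253; Balaban1985UV3, p.260 (bookkeeping — the bound is NOT in print)] -/
theorem exists_core_law_le (P : Params) (j : ℕ) :
    ∃ K : ℝ≥0∞, 1 ≤ K ∧ K ≠ ∞ ∧ ∀ (c : PBond P (j + 1)) (V : Idx P → Matrix.specialUnitaryGroup (Fin N) ℂ),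
      (∃ w : Matrix.specialUnitaryGroup (Fin N) ℂ, ∀ i : Idx P, dist1 (if IsCentral c i then (1 : Matrix.specialUnitaryGroup (Fin N) ℂ) else V i * w⁻¹) <
        (expMeanLogSU : LoopAverage (Matrix.specialUnitaryGroup (Fin N) ℂ)).δ) →
      (HaarData.haar : Measure (Matrix.specialUnitaryGroup (Fin N) ℂ)).map (fun w : Matrix.specialUnitaryGroup (Fin N) ℂ =>
          (if ∀ i : Idx P, dist1 (if IsCentral c i then (1 : Matrix.specialUnitaryGroup (Fin N) ℂ) else V i * w⁻¹) <
              (expMeanLogSU : LoopAverage (Matrix.specialUnitaryGroup (Fin N) ℂ)).δ then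
            (expMeanLogSU : LoopAverage (Matrix.specialUnitaryGroup (Fin N) ℂ)).avg
              (fun i : Idx P => if IsCentral c i then (1 : Matrix.specialUnitaryGroup (Fin N) ℂ) else V i * w⁻¹) else 1) * w) ≤
        K • (HaarData.haar : Measure (Matrix.specialUnitaryGroup (Fin N) ℂ)) := by
  classical
  have hK : ∀ c : PBond P (j + 1), ∃ K : ℝ≥0∞, 1 ≤ K ∧ K ≠ ∞ ∧ ∀ (V : Idx P → Matrix.specialUnitaryGroup (Fin N) ℂ),
      (HaarData.haar : Measure (Matrix.specialUnitaryGroup (Fin N) ℂ)).map (fun w : Matrix.specialUnitaryGroup (Fin N) ℂ =>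
          (if ∀ i : Idx P, dist1 (if IsCentral c i then (1 : Matrix.specialUnitaryGroup (Fin N) ℂ) else V i * w⁻¹) <
              (expMeanLogSU : LoopAverage (Matrix.specialUnitaryGroup (Fin N) ℂ)).δ then
            (expMeanLogSU : LoopAverage (Matrix.specialUnitaryGroup (Fin N) ℂ)).avg
              (fun i : Idx P => if IsCentral c i then (1 : Matrix.specialUnitaryGroup (Fin N) ℂ) else V i * w⁻¹) else 1) * w) ≤
        K • (HaarData.haar : Measure (Matrix.specialUnitaryGroup (Fin N) ℂ)) := by
    intro c
    obtain ⟨K, hK1, hKt, hK⟩ := exists_map_haar_le_of_kmat_on_open (N := N) (ι := {i : Idx P // ¬ IsCentral c i})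
      (fun _ => ((Fintype.card (Idx P) : ℝ))⁻¹) (fun _ => inv_nonneg.2 (Nat.cast_nonneg _)) (sum_weights_lt_one c)
    refine ⟨K, hK1, hKt, fun V => ?_⟩
    refine hK (fun i => V i) _ _ (isOpen_coreGuard c V)
      (measurable_core (expMeanLogSU : LoopAverage (Matrix.specialUnitaryGroup (Fin N) ℂ)) measurable_expMeanLogSU_E c V)
      (fun w hw i => guard_of_core c V w hw i) (fun w hw => ?_) (fun w hw => ?_)
    · have hw' : ∀ i : Idx P, dist1 (if IsCentral c i then (1 : Matrix.specialUnitaryGroup (Fin N) ℂ) else V i * w⁻¹) <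
          (expMeanLogSU : LoopAverage (Matrix.specialUnitaryGroup (Fin N) ℂ)).δ := hw
      rw [if_pos hw']; exact core_eq_kmat c V w hw'
    · have hw' : ¬ ∀ i : Idx P, dist1 (if IsCentral c i then (1 : Matrix.specialUnitaryGroup (Fin N) ℂ) else V i * w⁻¹) <
          (expMeanLogSU : LoopAverage (Matrix.specialUnitaryGroup (Fin N) ℂ)).δ := hw
      rw [if_neg hw', one_mul]
  choose K hK1 hKt hK using hK
  refine ⟨1 + ∑ c, K c, le_add_right le_rfl, ENNReal.add_ne_top.2 ⟨ENNReal.one_ne_top, ENNReal.sum_ne_top.2 fun c _ => hKt c⟩,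
    fun c V _ => (hK c V).trans (Measure.le_iff'.2 fun A => ?_)⟩
  rw [Measure.smul_apply, Measure.smul_apply, smul_eq_mul, smul_eq_mul]
  exact mul_le_mul' ((Finset.single_le_sum (fun _ _ => zero_le) (Finset.mem_univ c)).trans le_add_self) le_rfl

/-- ★★ **(H_K) FOR EVERY `N` WITHOUT HYPOTHESIS**: every guard-admitting one-variable fibre law of the typed (0.4) averaging with the printed `SU(N)` average is
`≤ K•Haar` for ONE `K < ∞` — part 24's `fibre_law_le_of_core` fed with `exists_core_law_le`.
[cite: Balaban1987RG1, (0.4) p.253 (bookkeeping — the bound is NOT in print)] -/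
theorem exists_fibre_law_le (hj : j + 1 ≤ P.m + P.K) :
    ∃ K : ℝ≥0∞, 1 ≤ K ∧ K ≠ ∞ ∧ ∀ (c : PBond P (j + 1)) (U : GaugeField P j (Matrix.specialUnitaryGroup (Fin N) ℂ)),
      (∃ g : Matrix.specialUnitaryGroup (Fin N) ℂ, Small (expMeanLogSU : LoopAverage (Matrix.specialUnitaryGroup (Fin N) ℂ)) (update U (centralBond c) g) c) →
      (HaarData.haar : Measure (Matrix.specialUnitaryGroup (Fin N) ℂ)).map
          (fun g => avgFun (expMeanLogSU : LoopAverage (Matrix.specialUnitaryGroup (Fin N) ℂ)) (update U (centralBond c) g) c) ≤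
        K • (HaarData.haar : Measure (Matrix.specialUnitaryGroup (Fin N) ℂ)) := by
  obtain ⟨K, hK1, hKt, hK⟩ := exists_core_law_le (N := N) P j
  exact ⟨K, hK1, hKt, fibre_law_le_of_core (expMeanLogSU : LoopAverage (Matrix.specialUnitaryGroup (Fin N) ℂ)) hj measurable_expMeanLogSU_E hK⟩

/-- ★★★ **PART 20's ONE-STEP EXTENSIVE TRANSPORT BOUND AT THE [B10] SLOT FOR EVERY `N` AND EVERY BLOCK SIZE, (H_K) DISCHARGED**: for the [B10] run of print on
`SU(N)`, every in-range level `j`, every `δ′`, there is `K ∈ [1, ∞)` (independent of the configuration and of `δ′`) with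
`h(δ′)^n • (avOfPrint N S₀ j)_*(dU) ≤ (h(δ′) + (K − 1)·h(δ_N + δ′)^{L^{d−1}−1})^n • dV`, `n = #PBond(j+1)`, `δ_N = min(1∕3, π∕N)` — part 24's
`smul_map_avOfPrint_le_of_core` fed with §1.  HONEST: `K` existential (a number at `N = 2` only: n08-w3's 27C); ONE RG step; the k-uniform `hmass` is NOT supplied; the
Yang–Mills mass gap is NOT proved. [cite: Balaban1985UV3, (2) p.256; Balaban1987RG1, (0.4) p.253 (bookkeeping — the bound is NOT in print)] -/
theorem exists_smul_map_avOfPrint_le {L : ℕ} (S₀ : Scales L) {j : ℕ} (hj : j + 1 ≤ S₀.P.m + S₀.P.K) :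
    ∃ K : ℝ≥0∞, 1 ≤ K ∧ K ≠ ∞ ∧ ∀ δ' : ℝ,
      (HaarData.haar : Measure (Matrix.specialUnitaryGroup (Fin N) ℂ)) {g : Matrix.specialUnitaryGroup (Fin N) ℂ | dist1 g < δ'} ^ Fintype.card (PBond S₀.P (j + 1)) •
          (fieldMeasure S₀.P j (Matrix.specialUnitaryGroup (Fin N) ℂ)).map (avOfPrint N S₀ j).avg ≤
        ((HaarData.haar : Measure (Matrix.specialUnitaryGroup (Fin N) ℂ)) {g : Matrix.specialUnitaryGroup (Fin N) ℂ | dist1 g < δ'} +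
            (K - 1) * (HaarData.haar : Measure (Matrix.specialUnitaryGroup (Fin N) ℂ))
              {g : Matrix.specialUnitaryGroup (Fin N) ℂ | dist1 g < min (1 / 3) (Real.pi / N) + δ'} ^ (S₀.P.L ^ (S₀.P.d - 1) - 1)) ^
            Fintype.card (PBond S₀.P (j + 1)) •
          fieldMeasure S₀.P (j + 1) (Matrix.specialUnitaryGroup (Fin N) ℂ) := by
  obtain ⟨K, hK1, hKt, hK⟩ := exists_core_law_le (N := N) S₀.P j
  exact ⟨K, hK1, hKt, fun δ' => smul_map_avOfPrint_le_of_core N S₀ hj hK1 hKt hK δ'⟩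

end Slot

end Summit.QuantumFields.YangMills.BalabanUVNodes.N08HaarCompatibilityGuardCoreLawSUN

end
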